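import Summits.QuantumFields.BalabanUV.Beta.D1BFx.SortedKernels
import Summits.QuantumFields.BalabanUV.Beta.TameKernelCalculus
import Literature.MathematicalPhysics.QuantumFieldTheory.Balaban1983to89.Beta.BlochFibreMatrix

/-!
# `BalabanUV.Beta.D1BFx.SortedReblocking` — road «BF-x», binder row D1, slot (K), debt X₃(ii) ROUTE T, brick **TA1** PART 2:
# RE-BLOCKING — a fine `ℤ^D` kernel `K x x′ a b` (the cell's `ExpKernelCalculus.MKer D F`) read over the COARSE lattice with the position in
# the block as a FIBRE: `x = repZ z + n•y ↔ (y, z)`, `z ∈ (ℤ∕n)^D`; composition `comp ↔ compF`, block covariance ⟹ joint periodicity of every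
# fibre, `Decays ⟹` absolutely summable rows with a uniform row bound; and the TORUS DICTIONARY `Site D p × (ℤ∕n)^D ≃ Site D (n·p)` under which
# the coarse-base periodisation `periodiseF p (reblock n K)` IS an4's fine-torus periodisation `periodise₂ (n·p)` of the fibres of `K`

WHY (K-ASSEMBLY-SPEC v1 §1 TA1 «fine bonds period `s`, coarse bonds period `p = s∕n`»; PART 1 = `SortedKernels`).  With the sorts as fibres over
ONE base lattice (PART 1), the base must be the COARSE lattice (period `p`): the fine-bond sort becomes the fibre `(ℤ∕n)^D × F` by re-blocking,
the coarse-bond sort the fibre `F`, the comb sort a sub-fibre of `(ℤ∕n)^D` (PART 3, `SortedPack`).  This file is the re-blocking layer for ONE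
fine sort, generic in `D`, `F`, `n ≥ 1`.
CONTENT (all [folklore] ∕ [our object]):
* §1 [our object] `finePt n y z := repZ z + n • y`; [folklore] `proj_finePt`, `quo_finePt`, `finePt_quo_proj` (the cell's `LatticeForm.repZ`∕`quo`,
  `BlochFibreMatrix.eq_repZ_add_zsmul_quo` BY NAME), the RE-BLOCKING EQUIVALENCE **`blockEquiv n : ℤ^D × (ℤ∕n)^D ≃ ℤ^D`**, injectivity,
  `finePt_add_zsmul`, `finePt_imageShift` (`imageShift p` on the base ↦ `imageShift (n·p)` on the fine lattice).
* §2 [our object] **`reblock n K : FKer D ((ℤ∕n)^D × F) ((ℤ∕n)^D × F)`**; [folklore] **`reblock_comp`** (`reblock (comp A K) = compF (reblock A) (reblock K)`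
  for summable middle slices, e.g. tame factors `reblock_comp_tame`), **`isPeriodic₂_reblock`** (n-block covariance `shiftK (n•t) K = K` ⟹ every
  fibre jointly `p`-periodic, every `p`), **`summable_abs_reblock`** ∕ **`rowBound_reblock`** (`Decays K C δ`, `δ > 0` ⟹ row bound `C·Zl D δ`),
  **`reblock_idK`** (`reblock n idK = kdeltaF`).
* §3 [our object] the torus re-blocking **`torusBlockEquiv n p : Site D p × (ℤ∕n)^D ≃ Site D (n·p)`**; [folklore] **`periodiseF_reblock`**:
  `periodiseF p (reblock n K) ((ȳ,(z,a)),(ȳ′,(z′,b))) = periodise₂ (n·p) (K · · a b) (torusBlockEquiv (ȳ,z)) (torusBlockEquiv (ȳ′,z′))` for jointly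
  `(n·p)`-periodic fibres with summable rows — so TA2∕TA3, which periodise on the fine torus `Site D (n·p)`, and TB1∕TB2, which invert sorted
  block matrices over `Site D p`, speak about the SAME matrices.
NOT HERE: the second (coarse-bond) and third (comb) sorts and the cell's embedded `Fib d` packs (PART 3); arrays (TA2); estimates.

HONEST FRAMING (cell contract, verbatim): «discharging `BetaPertH` makes Bałaban's UV stability UNCONDITIONAL — a real constructive-QFT
result; it is NOT the continuum limit and NOT the Clay problem.»  HONEST DEPENDENCY (verbatim): «continuum YM on T⁴ ⇐ BetaPertH ∧ nine
spine estimates (0/9 proved); BetaPertH ⇐ (D1) ∧ (D4) ∧ CAP+tail; G-an2-4 gates asym, D1 and NE2/3/4.»  [folklore] bookkeeping; no `Prop` is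
minted, nothing is cited, no wall binder is instantiated; 0 sorry.  NOT D1, NOT BetaPertH, NOT summit progress.  ABSOLUTE RULE (cell,
verbatim): «No internally-minted statement may enter as a cited fact. Every hypothesis is either kernel-proved in this package or a verbatim
quotation of a PUBLISHED theorem with page reference. The manuscript(s) under audit are NOT citable for their own disputed steps — they are the
thing under adjudication; programme-internal (2001/route/tribunal) claims are never citable.»
Provenance: D1 formalisation swarm, unit `b2b-balaban-beta-d1-formalise-leaf-03` (gen 8), claim «K-TA1», 2026-08-20.
-/

noncomputable section

namespace Summit.QuantumFields.BalabanUV.Beta.D1BFx.SortedReblocking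

open Literature.Probability.LatticeModels (TorusSite Torus.proj Torus.proj_apply)
open Literature.MathematicalPhysics.QuantumFieldTheory.LatticeForm (repZ proj_repZ proj_add_zsmul quo)
open Literature.MathematicalPhysics.QuantumFieldTheory.Balaban1983to89
open Literature.MathematicalPhysics.QuantumFieldTheory.Balaban1983to89.Beta
open Literature.MathematicalPhysics.QuantumFieldTheory.Balaban1983to89.Beta.BlochFibreMatrix (repZ_nonneg repZ_lt
  eq_repZ_add_zsmul_quo)
open ExpKernelCalculus (MKer Decays comp shiftK Zl tsum_exp_shift summable_exp_shift)
open Summit.QuantumFields.BalabanUV.Beta.TameKernelCalculus (Tame slice_tame)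
open Summit.QuantumFields.BalabanUV.Beta.D1BFx.FibredPeriodisation
open Summit.QuantumFields.BalabanUV.Beta.D1BFx.SortedKernels
open scoped BigOperators

variable {D : ℕ} {F : Type*} {n : ℕ}

/-! ## §1 The re-blocking equivalence `ℤ^D × (ℤ∕n)^D ≃ ℤ^D` -/

/-- [our object] The fine point of block `y` at in-block position `z`: `repZ z + n • y` (box representative `repZ z ∈ [0,n)^D`). -/
def finePt (n : ℕ) (y : Fin D → ℤ) (z : TorusSite D n) : Fin D → ℤ := repZ z + (n : ℤ) • y

/-- [our object] Coordinates of `finePt`. -/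
theorem finePt_apply (y : Fin D → ℤ) (z : TorusSite D n) (i : Fin D) : finePt n y z i = repZ z i + (n : ℤ) * y i := by
  simp [finePt]

/-- [folklore] The residue of `finePt n y z` is `z`. -/
theorem proj_finePt [NeZero n] (y : Fin D → ℤ) (z : TorusSite D n) : Torus.proj n (finePt n y z) = z := by
  rw [finePt, proj_add_zsmul, proj_repZ]

/-- [folklore] The block index of `finePt n y z` is `y`. -/
theorem quo_finePt [NeZero n] (y : Fin D → ℤ) (z : TorusSite D n) : quo n (finePt n y z) = y := by
  funext i
  have h0 := repZ_nonneg z i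
  have h1 := repZ_lt z i
  have hn : (n : ℤ) ≠ 0 := by exact_mod_cast NeZero.ne n
  simp only [quo, finePt_apply]
  rw [Int.add_mul_ediv_left _ _ hn, Int.ediv_eq_zero_of_lt h0 h1, zero_add]

/-- [folklore] Every fine point is the fine point of its block at its residue (`BlochFibreMatrix.eq_repZ_add_zsmul_quo`). -/
theorem finePt_quo_proj [NeZero n] (x : Fin D → ℤ) : finePt n (quo n x) (Torus.proj n x) = x :=
  (eq_repZ_add_zsmul_quo (N := n) x).symm

/-- [our object] **THE RE-BLOCKING EQUIVALENCE** `(y, z) ↦ repZ z + n • y`, inverse `x ↦ (quo n x, proj n x)`. -/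
def blockEquiv (n : ℕ) [NeZero n] : (Fin D → ℤ) × TorusSite D n ≃ (Fin D → ℤ) where
  toFun p := finePt n p.1 p.2
  invFun x := (quo n x, Torus.proj n x)
  left_inv p := by
    obtain ⟨y, z⟩ := p
    simp only [quo_finePt, proj_finePt]
  right_inv x := finePt_quo_proj x

/-- [our object] Unfolding of `blockEquiv`. -/
@[simp] theorem blockEquiv_apply [NeZero n] (p : (Fin D → ℤ) × TorusSite D n) : blockEquiv n p = finePt n p.1 p.2 := rfl

/-- [folklore] `finePt` is jointly injective. -/
theorem finePt_injective [NeZero n] : Function.Injective fun p : (Fin D → ℤ) × TorusSite D n => finePt n p.1 p.2 :=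
  (blockEquiv n).injective

/-- [folklore] `finePt n · z` is injective for each in-block position `z`. -/
theorem finePt_left_injective [NeZero n] (z : TorusSite D n) : Function.Injective fun y : Fin D → ℤ => finePt n y z := by
  intro y y' h
  have := finePt_injective (n := n) (a₁ := (y, z)) (a₂ := (y', z)) h
  exact (Prod.mk.inj this).1

/-- [folklore] Two fine points agree iff block index and in-block position agree. -/
theorem finePt_eq_iff [NeZero n] {y y' : Fin D → ℤ} {z z' : TorusSite D n} :
    finePt n y z = finePt n y' z' ↔ y = y' ∧ z = z' := by
  constructor
  · intro h
    exact Prod.mk.inj (finePt_injective (n := n) (a₁ := (y, z)) (a₂ := (y', z')) h)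
  · rintro ⟨rfl, rfl⟩; rfl

/-- [folklore] Shifting the block index shifts the fine point by the block period. -/
theorem finePt_add (y t : Fin D → ℤ) (z : TorusSite D n) : finePt n (y + t) z = finePt n y z + (n : ℤ) • t := by
  simp only [finePt, smul_add, add_assoc]

/-- [folklore] Image shifts of period `p` on the base lattice are image shifts of period `n·p` on the fine lattice. -/
theorem finePt_imageShift (p : ℕ) (y t : Fin D → ℤ) (z : TorusSite D n) :
    finePt n (imageShift p y t) z = imageShift (n * p) (finePt n y z) t := by
  funext i
  simp only [finePt_apply, imageShift, Nat.cast_mul]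
  ring

/-- [folklore] A fine image shift of period `n·p` written as a fine translation by `n • (p • t)`. -/
theorem imageShift_mul_eq_add (p : ℕ) (x t : Fin D → ℤ) : imageShift (n * p) x t = x + (n : ℤ) • ((p : ℤ) • t) := by
  funext i
  simp only [imageShift, Nat.cast_mul, Pi.add_apply, Pi.smul_apply, smul_eq_mul]
  ring

/-! ## §2 Re-blocking a fine kernel over the coarse lattice -/

/-- [our object] **RE-BLOCKING**: the fine kernel `K` as a fibred kernel over the coarse lattice with fibre `(position in block) × F`. -/
def reblock (n : ℕ) (K : MKer D F) : FKer D (TorusSite D n × F) (TorusSite D n × F) :=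
  fun i j => K (finePt n i.1 i.2.1) (finePt n j.1 j.2.1) i.2.2 j.2.2

/-- [our object] Unfolding of `reblock`. -/
@[simp] theorem reblock_apply (K : MKer D F) (y y' : Fin D → ℤ) (z z' : TorusSite D n) (a b : F) :
    reblock n K (y, (z, a)) (y', (z', b)) = K (finePt n y z) (finePt n y' z') a b := rfl

/-- [our object] Fibres of `reblock`. -/
theorem Kfib_reblock (K : MKer D F) (z z' : TorusSite D n) (a b : F) (y y' : Fin D → ℤ) :
    Kfib (reblock n K) (z, a) (z', b) y y' = K (finePt n y z) (finePt n y' z') a b := rfl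

/-- [folklore] **RE-BLOCKING THE IDENTITY**: the Kronecker kernel of the fine lattice re-blocks to the fibred Kronecker kernel. -/
theorem reblock_idK [NeZero n] [DecidableEq F] :
    reblock n (HessKerSchurResolvent.idK : MKer D F) = (kdeltaF : FKer D (TorusSite D n × F) (TorusSite D n × F)) := by
  funext ⟨y, z, a⟩ ⟨y', z', b⟩
  simp only [reblock_apply, HessKerSchurResolvent.idK_apply, kdeltaF, Prod.mk.injEq, finePt_eq_iff, and_assoc]

/-- [folklore] **RE-BLOCKING IS MULTIPLICATIVE**: `reblock (A ∘ K) = reblock A ∘ reblock K` (`comp ↦ compF`) whenever the middle slices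
`y ↦ A x y a f · K y z f b` are summable (the fine middle sum re-indexed by `blockEquiv` and split into the finite fibre sum). -/
theorem reblock_comp [NeZero n] [Fintype F] {A K : MKer D F} (h : ∀ x z a f b, Summable fun y => A x y a f * K y z f b) :
    reblock n (comp A K) = compF (reblock n A) (reblock n K) := by
  funext ⟨y, z, a⟩ ⟨y', z', b⟩
  simp only [reblock_apply, compF, ExpKernelCalculus.comp]
  set X := finePt n y z with hX
  set X' := finePt n y' z' with hX'
  calc ∑' x', ∑ f, A X x' a f * K x' X' f b
      = ∑ f, ∑' x', A X x' a f * K x' X' f b := Summable.tsum_finsetSum fun f _ => h X X' a f b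
    _ = ∑ f, ∑' q : (Fin D → ℤ) × TorusSite D n, A X (finePt n q.1 q.2) a f * K (finePt n q.1 q.2) X' f b := by
        refine Finset.sum_congr rfl fun f _ => ?_
        exact ((blockEquiv n).tsum_eq fun x' => A X x' a f * K x' X' f b).symm
    _ = ∑ f, ∑ w : TorusSite D n, ∑' y'', A X (finePt n y'' w) a f * K (finePt n y'' w) X' f b := by
        refine Finset.sum_congr rfl fun f _ => ?_
        have hs : ∀ w : TorusSite D n, Summable fun y'' : Fin D → ℤ =>
            |A X (finePt n y'' w) a f * K (finePt n y'' w) X' f b| := fun w =>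
          (h X X' a f b).abs.comp_injective (finePt_left_injective w)
        exact (tsum_prod_fintype_right (F := fun q : (Fin D → ℤ) × TorusSite D n =>
          A X (finePt n q.1 q.2) a f * K (finePt n q.1 q.2) X' f b) hs).2
    _ = ∑ wf : TorusSite D n × F, ∑' y'', A X (finePt n y'' wf.1) a wf.2 * K (finePt n y'' wf.1) X' wf.2 b := by
        rw [Finset.sum_comm, ← Fintype.sum_prod_type']
    _ = _ := by rfl

/-- [folklore] Tame factors have summable middle slices, so `reblock` is multiplicative on them. -/
theorem reblock_comp_tame [NeZero n] [Fintype F] {A K : MKer D F} (hA : Tame A) (hK : Tame K) :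
    reblock n (comp A K) = compF (reblock n A) (reblock n K) :=
  reblock_comp fun x z a f b => slice_tame hA hK x z a f b

/-- [folklore] **BLOCK COVARIANCE ⟹ JOINT PERIODICITY OF EVERY FIBRE**: if `K` is covariant under the block translations
(`shiftK (n • t) K = K` for all `t`), every fibre of `reblock n K` is jointly `p`-periodic on the base lattice, for EVERY `p`. -/
theorem isPeriodic₂_reblock {K : MKer D F} (hK : ∀ t : Fin D → ℤ, shiftK ((n : ℤ) • t) K = K) (p : ℕ) (i j : TorusSite D n × F) :
    IsPeriodic₂ p (Kfib (reblock n K) i j) := by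
  obtain ⟨z, a⟩ := i
  obtain ⟨z', b⟩ := j
  intro y y' t
  rw [Kfib_reblock, Kfib_reblock, finePt_imageShift, finePt_imageShift, imageShift_mul_eq_add, imageShift_mul_eq_add]
  have e := hK ((p : ℤ) • t)
  exact congrFun (congrFun (congrFun (congrFun e (finePt n y z)) (finePt n y' z')) a) b

/-- [folklore] A decaying kernel has absolutely summable fine rows. -/
theorem summable_abs_row {K : MKer D F} {C δ : ℝ} (hK : Decays K C δ) (hδ : 0 < δ) (x : Fin D → ℤ) (a b : F) :
    Summable fun x' : Fin D → ℤ => |K x x' a b| :=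
  Summable.of_nonneg_of_le (fun _ => abs_nonneg _) (fun x' => hK x x' a b) ((summable_exp_shift hδ x).mul_left C)

/-- [folklore] **`Decays` ⟹ ABSOLUTELY SUMMABLE ROWS OF EVERY FIBRE** of the re-blocked kernel (sub-series of a fine row). -/
theorem summable_abs_reblock [NeZero n] {K : MKer D F} {C δ : ℝ} (hK : Decays K C δ) (hδ : 0 < δ) (i j : TorusSite D n × F)
    (y : Fin D → ℤ) : Summable fun y' => |Kfib (reblock n K) i j y y'| :=
  (summable_abs_row hK hδ (finePt n y i.1) i.2 j.2).comp_injective (finePt_left_injective j.1)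

/-- [folklore] Plain row summability of every fibre of the re-blocked kernel. -/
theorem summable_reblock [NeZero n] {K : MKer D F} {C δ : ℝ} (hK : Decays K C δ) (hδ : 0 < δ) (i j : TorusSite D n × F)
    (y : Fin D → ℤ) : Summable (Kfib (reblock n K) i j y) :=
  (summable_abs_reblock hK hδ i j y).of_abs

/-- [folklore] **`Decays` ⟹ UNIFORM ROW BOUND `C·Zl D δ` FOR EVERY FIBRE** of the re-blocked kernel. -/
theorem rowBound_reblock [NeZero n] {K : MKer D F} {C δ : ℝ} (hK : Decays K C δ) (hδ : 0 < δ) (i j : TorusSite D n × F) :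
    RowBound (Kfib (reblock n K) i j) (C * Zl D δ) := by
  intro y
  refine ⟨summable_abs_reblock hK hδ i j y, ?_⟩
  set X := finePt n y i.1
  have hs := summable_abs_row hK hδ X i.2 j.2
  have h1 : ∑' y', |Kfib (reblock n K) i j y y'| ≤ ∑' x', |K X x' i.2 j.2| :=
    tsum_comp_le_tsum_of_inj hs (fun _ => abs_nonneg _) (finePt_left_injective j.1)
  have h2 : ∑' x', |K X x' i.2 j.2| ≤ ∑' x', C * Real.exp (-δ * B12Sec2to5.l1 (X - x')) :=
    Summable.tsum_le_tsum (fun x' => hK X x' i.2 j.2) hs ((summable_exp_shift hδ X).mul_left C)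
  rw [tsum_mul_left, tsum_exp_shift] at h2
  exact h1.trans h2

/-! ## §3 The torus dictionary: coarse torus × block position = fine torus -/

section Torus
variable {p : ℕ} [NeZero n] [NeZero p]

/-- [folklore] `n·p ≠ 0`. -/
instance instNeZeroMul : NeZero (n * p) := ⟨mul_ne_zero (NeZero.ne n) (NeZero.ne p)⟩

omit [NeZero n] [NeZero p] in
/-- [folklore] Base translations by `p • t` are invisible on the coarse torus. -/
theorem siteOf_add_zsmul (y t : Fin D → ℤ) : siteOf D p (y + (p : ℤ) • t) = siteOf D p y := by
  funext i
  simp only [siteOf, Pi.add_apply, Pi.smul_apply, smul_eq_mul, Int.cast_add, Int.cast_mul, Int.cast_natCast, ZMod.natCast_self,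
    zero_mul, add_zero]

omit [NeZero n] [NeZero p] in
/-- [folklore] A base translation by `p • t` inside `finePt` is a fine translation by `(n·p) • t`, invisible on the fine torus. -/
theorem siteOf_finePt_add_zsmul (y t : Fin D → ℤ) (z : TorusSite D n) :
    siteOf D (n * p) (finePt n (y + (p : ℤ) • t) z) = siteOf D (n * p) (finePt n y z) := by
  funext i
  have h0 : ((n : ℤ) : ZMod (n * p)) * ((p : ℤ) : ZMod (n * p)) = 0 := by
    rw [Int.cast_natCast, Int.cast_natCast, ← Nat.cast_mul, ZMod.natCast_self]
  simp only [siteOf, finePt_apply, Pi.add_apply, Pi.smul_apply, smul_eq_mul, Int.cast_add, Int.cast_mul]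
  rw [mul_add, ← mul_assoc ((n : ℤ) : ZMod (n * p)), h0, zero_mul, add_zero]

/-- [folklore] Representatives: `windowMap p (siteOf p y) = y + p • t` for some `t`. -/
theorem exists_windowMap_siteOf (y : Fin D → ℤ) : ∃ t : Fin D → ℤ, windowMap D p (siteOf D p y) = y + (p : ℤ) • t := by
  obtain ⟨m, hm⟩ := exists_eq_imageShift_of_siteOf_eq (s := p) (y := y) (x := siteOf D p y) rfl
  refine ⟨-m, ?_⟩
  funext i
  have := congrFun hm i
  simp only [imageShift] at this
  simp only [Pi.add_apply, Pi.smul_apply, smul_eq_mul, Pi.neg_apply]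
  linarith

/-- [folklore] `quo n` is additive along block translations. -/
theorem quo_add_zsmul (x t : Fin D → ℤ) : quo n (x + (n : ℤ) • t) = quo n x + t := by
  funext i
  have hn : (n : ℤ) ≠ 0 := by exact_mod_cast NeZero.ne n
  simp only [quo, Pi.add_apply, Pi.smul_apply, smul_eq_mul]
  rw [Int.add_mul_ediv_left _ _ hn]

/-- [our object] **THE TORUS RE-BLOCKING EQUIVALENCE** `Site D p × (ℤ∕n)^D ≃ Site D (n·p)`: `(ȳ, z) ↦ [finePt n y z]` for any representative `y`
of `ȳ`; inverse `x̂ ↦ ([quo n x], proj n x)` for any representative `x`. -/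
def torusBlockEquiv (n p : ℕ) [NeZero n] [NeZero p] : Beta.Site D p × TorusSite D n ≃ Beta.Site D (n * p) where
  toFun q := siteOf D (n * p) (finePt n (windowMap D p q.1) q.2)
  invFun x := (siteOf D p (quo n (windowMap D (n * p) x)), Torus.proj n (windowMap D (n * p) x))
  left_inv q := by
    obtain ⟨ybar, z⟩ := q
    obtain ⟨m, hm⟩ := exists_eq_imageShift_of_siteOf_eq (s := n * p) (y := finePt n (windowMap D p ybar) z)
      (x := siteOf D (n * p) (finePt n (windowMap D p ybar) z)) rfl
    rw [imageShift_mul_eq_add] at hm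
    -- the window representative of `[finePt n y z]` is the fine point of the translated block index `y − p•m`
    have hw : windowMap D (n * p) (siteOf D (n * p) (finePt n (windowMap D p ybar) z))
        = finePt n (windowMap D p ybar + (p : ℤ) • (-m)) z := by
      rw [finePt_add, smul_neg, smul_neg]
      exact eq_add_neg_of_add_eq hm.symm
    simp only [hw, quo_finePt, proj_finePt, siteOf_add_zsmul, siteOf_windowMap]
  right_inv x := by
    obtain ⟨t, ht⟩ := exists_windowMap_siteOf (D := D) (p := p) (quo n (windowMap D (n * p) x))
    simp only [ht, siteOf_finePt_add_zsmul, finePt_quo_proj, siteOf_windowMap]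

/-- [our object] Unfolding of `torusBlockEquiv`. -/
theorem torusBlockEquiv_apply (q : Beta.Site D p × TorusSite D n) :
    torusBlockEquiv n p q = siteOf D (n * p) (finePt n (windowMap D p q.1) q.2) := rfl

/-- [folklore] **THE TWO PERIODISATIONS AGREE**: the coarse-base periodisation (period `p`) of the re-blocked kernel is an4's fine-torus
periodisation (period `n·p`) of the fibre `K · · a b`, read through `torusBlockEquiv` — for jointly `(n·p)`-periodic fibres with summable rows. -/
theorem periodiseF_reblock {K : MKer D F} {a b : F} (hper : IsPeriodic₂ (n * p) (fun x x' => K x x' a b))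
    (hrow : ∀ x, Summable fun x' => K x x' a b) (ybar ybar' : Beta.Site D p) (z z' : TorusSite D n) :
    periodiseF p (reblock n K) (ybar, (z, a)) (ybar', (z', b))
      = periodise₂ (n * p) (fun x x' => K x x' a b) (torusBlockEquiv n p (ybar, z)) (torusBlockEquiv n p (ybar', z')) := by
  rw [periodiseF_apply, torusBlockEquiv_apply, torusBlockEquiv_apply,
    periodise₂_eq_tsum_of_rep hper hrow rfl rfl]
  unfold periodise₂
  refine tsum_congr fun m => ?_
  rw [Kfib_reblock, finePt_imageShift]

end Torus

end Summit.QuantumFields.BalabanUV.Beta.D1BFx.SortedReblocking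

end
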